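import Literature.RingTheory.KTheory.MilnorKWittRing
import Literature.RingTheory.KTheory.MilnorKSumOfSquares
import HarnessLib

/-!
# The signature `W(F) → ℤ` of an ordering: it carries `I` to `2ℤ`, `Iⁿ` to `2ⁿℤ` and `⋂ₙ Iⁿ` to `0`
# (Milnor, *Algebraic K-theory and quadratic forms*, Invent. Math. 9 (1970), §4)

Family `hodge`, lane `lit-hodgefound` (foundations library; seat `lit-hodgefound-p27`, generation 40, row g40-#18);
topic `RingTheory/KTheory`.  Sequel of `MilnorKWittRing` (g40-#17: the Witt ring `WittRing F` by generators `gen F a = (a)`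
and relations `rels`, the fundamental ideal `fundIdeal F = I`) and `MilnorKSumOfSquares` (g40-#4: total preorderings,
`exists_total_ringPreordering`, `mul_not_mem`, `mul_mem_of_not_mem`).  DEFINITIONS WITH BODIES (`sgnInt`, `sgnLift`,
`signature`) and PROVED THEOREMS; no named fact, no instance, no notation, 0 `sorry`, net debt 0 (D-0026).

## The source, verbatim

J. Milnor, *Algebraic K-theory and quadratic forms*, Invent. Math. 9 (1970) 318–344 (held `paper:doi-10-1007-bf01425486`;
bib key `Milnor1970`), §4, proof of Lemma 4.5 (p0016 L2–L5, L14–L15): «As to the intersection of the ideals Iⁿ, first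
note that each embedding of F in the real field gives rise to a ring homomorphism WF → Wℝ ≅ Z called the signature.
[…] But each such signature carries the ideal IF to 2Z, and hence carries the intersection of the ideals IⁿF to
∩ 2ⁿZ = 0.»

## What is formalised

For an ORDERING of `F`, given as a total preordering `P` (`−1 ∉ P`, `P + P ⊆ P`, `P·P ⊆ P`, squares in `P`,
`∀ a, a ∈ P ∨ −a ∈ P` — by Artin–Schreier the same datum as Milnor's embedding of `F` in a real closed field; such `P`
exist iff `−1` is not a sum of squares, `exists_total_ringPreordering`):
* `sgnInt F P a = ±1`, multiplicative (`sgnInt_mul`), `sgnInt_neg`, constant on square classes (`sgnInt_mul_sq`), and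
  compatible with the Witt relation `(a) + (b) = (c) + (abc)`, `c = λ²a + μ²b` (**`sgnInt_add_rel`**);
* hence (universal properties of `FreeCommRing` and of the quotient) **the signature `signature F P hP : W(F) →+* ℤ`,
  `(a) ↦ sign_P(a)`** («a ring homomorphism WF → Wℝ ≅ Z called the signature»);
* **`map_fundIdeal_le`: the signature carries `I` into `2ℤ`**, **`two_pow_dvd_signature`: `Iⁿ` into `2ⁿℤ`**, and
  **`signature_eq_zero_of_forall_mem`: `⋂ₙ Iⁿ` to `0`**;
* consequence: for a formally real field `ℤ → W(F)` is injective (`intCast_injective`, `intCast_ne_zero`).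

## References

* [Milnor1970] J. Milnor, *Algebraic K-theory and quadratic forms*, Invent. Math. 9 (1970) 318–344 — §4, the signature
  (p0016 L2–L5, L14–L15).
* [Knebusch2010] M. Knebusch, *Specialization of quadratic and symmetric bilinear forms*, Springer 2010 — Ch. 1,
  Thm. 1.11 (the presentation of `W(F)` used by `MilnorKWittRing`).

Provenance: lane `lit-hodgefound`, seat `lit-hodgefound-p27` gen 40 (agent `literature-prover-lit-hodgefound-p27-g40-0`),
row g40-#18.
-/

set_option autoImplicit false

noncomputable section

namespace Literature.RingTheory.KTheory

open Function

/-! ### the signature of an ordering -/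

section Signature

variable (F : Type*) [Field F]

namespace WittRing

open Classical in
/-- The sign `sign_P(a) = ±1 ∈ ℤ` of a unit with respect to the (total) preordering `P` — the signature of the one-dimensional
form `⟨a⟩`. [cite: Milnor1970, §4 «a ring homomorphism WF → Wℝ ≅ Z called the signature» (p0016 L2–L5)] -/
def sgnInt (P : RingPreordering F) (a : Fˣ) : ℤ := if (a : F) ∈ P then 1 else -1

variable {F}

/-- `sign_P(a) = 1` for `a ∈ P`. [cite: Milnor1970, §4, the signature (p0016 L2–L5)] -/
theorem sgnInt_of_mem {P : RingPreordering F} {a : Fˣ} (h : (a : F) ∈ P) : sgnInt F P a = 1 := by simp [sgnInt, h]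

/-- `sign_P(a) = −1` for `a ∉ P`. [cite: Milnor1970, §4, the signature (p0016 L2–L5)] -/
theorem sgnInt_of_not_mem {P : RingPreordering F} {a : Fˣ} (h : (a : F) ∉ P) : sgnInt F P a = -1 := by simp [sgnInt, h]

/-- `sign_P(1) = 1`. [cite: Milnor1970, §4, the signature (p0016 L2–L5)] -/
theorem sgnInt_one (P : RingPreordering F) : sgnInt F P 1 = 1 := sgnInt_of_mem (by rw [Units.val_one]; exact P.one_mem')

/-- A unit and its negative are not both non-negative (`−1 ∉ P`). [cite: Milnor1970, §4, the signature (p0016 L2–L5)] -/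
theorem neg_not_mem_of_mem {P : RingPreordering F} {a : Fˣ} (h : (a : F) ∈ P) : -(a : F) ∉ P := by
  intro h'
  apply P.neg_one_notMem'
  have ha : (a : F) ≠ 0 := a.ne_zero
  have h1 : (-1 : F) = -(a : F) * a * ((a : F)⁻¹) ^ 2 := by field_simp
  rw [h1]
  exact P.mul_mem' (P.mul_mem' h' h) (P.mem_of_isSquare' ⟨_, pow_two _⟩)

/-- `sign_P(−a) = −sign_P(a)` (for a total `P`). [cite: Milnor1970, §4, the signature (p0016 L2–L5)] -/
theorem sgnInt_neg {P : RingPreordering F} (hP : ∀ a : F, a ∈ P ∨ -a ∈ P) (a : Fˣ) : sgnInt F P (-a) = -sgnInt F P a := by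
  by_cases h : (a : F) ∈ P
  · rw [sgnInt_of_mem h, sgnInt_of_not_mem (by rw [Units.val_neg]; exact neg_not_mem_of_mem h)]
  · rcases hP a with h' | h'
    · exact absurd h' h
    · rw [sgnInt_of_not_mem h, sgnInt_of_mem (by rw [Units.val_neg]; exact h'), neg_neg]

/-- `sign_P(ab) = sign_P(a) sign_P(b)` (for a total `P`): the relation `(a)(b) = (ab)`. [cite: Milnor1970, §4, the signature (p0016 L2–L5)] -/
theorem sgnInt_mul {P : RingPreordering F} (hP : ∀ a : F, a ∈ P ∨ -a ∈ P) (a b : Fˣ) :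
    sgnInt F P (a * b) = sgnInt F P a * sgnInt F P b := by
  by_cases ha : (a : F) ∈ P <;> by_cases hb : (b : F) ∈ P
  · rw [sgnInt_of_mem ha, sgnInt_of_mem hb, sgnInt_of_mem (by rw [Units.val_mul]; exact P.mul_mem' ha hb)]; norm_num
  · rw [sgnInt_of_mem ha, sgnInt_of_not_mem hb, sgnInt_of_not_mem (by rw [Units.val_mul]; exact mul_not_mem ha a.ne_zero hb)]
    norm_num
  · rw [sgnInt_of_not_mem ha, sgnInt_of_mem hb,
      sgnInt_of_not_mem (by rw [Units.val_mul, mul_comm]; exact mul_not_mem hb b.ne_zero ha)]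
    norm_num
  · rw [sgnInt_of_not_mem ha, sgnInt_of_not_mem hb, sgnInt_of_mem (by rw [Units.val_mul]; exact mul_mem_of_not_mem hP ha hb)]
    norm_num

/-- `sign_P(ab²) = sign_P(a)`: the square-class relation. [cite: Milnor1970, §4, the signature (p0016 L2–L5)] -/
theorem sgnInt_mul_sq {P : RingPreordering F} (hP : ∀ a : F, a ∈ P ∨ -a ∈ P) (a b : Fˣ) : sgnInt F P (a * b ^ 2) = sgnInt F P a := by
  rw [sgnInt_mul hP, sgnInt_of_mem (a := b ^ 2) (by rw [Units.val_pow_eq_pow_val]; exact P.mem_of_isSquare' ⟨_, pow_two _⟩),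
    mul_one]

/-- **The Witt relation holds for signs: `sign(a) + sign(b) = sign(c) + sign(abc)` when `c = λ²a + μ²b`.** [cite: Milnor1970, §4, the signature (p0016 L2–L5)] -/
theorem sgnInt_add_rel {P : RingPreordering F} (hP : ∀ a : F, a ∈ P ∨ -a ∈ P) {a b l m c : Fˣ}
    (h : (c : F) = (l : F) ^ 2 * a + (m : F) ^ 2 * b) :
    sgnInt F P a + sgnInt F P b = sgnInt F P c + sgnInt F P (a * b * c) := by
  rw [sgnInt_mul hP, sgnInt_mul hP]
  have hl : ((l : F)) ^ 2 ∈ P := P.mem_of_isSquare' ⟨_, pow_two _⟩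
  have hm : ((m : F)) ^ 2 ∈ P := P.mem_of_isSquare' ⟨_, pow_two _⟩
  by_cases ha : (a : F) ∈ P <;> by_cases hb : (b : F) ∈ P
  · have hc : (c : F) ∈ P := by rw [h]; exact P.add_mem' (P.mul_mem' hl ha) (P.mul_mem' hm hb)
    rw [sgnInt_of_mem ha, sgnInt_of_mem hb, sgnInt_of_mem hc]; norm_num
  · rw [sgnInt_of_mem ha, sgnInt_of_not_mem hb]
    by_cases hc : (c : F) ∈ P
    · rw [sgnInt_of_mem hc]; norm_num
    · rw [sgnInt_of_not_mem hc]; norm_num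
  · rw [sgnInt_of_not_mem ha, sgnInt_of_mem hb]
    by_cases hc : (c : F) ∈ P
    · rw [sgnInt_of_mem hc]; norm_num
    · rw [sgnInt_of_not_mem hc]; norm_num
  · have ha' : -(a : F) ∈ P := (hP a).resolve_left ha
    have hb' : -(b : F) ∈ P := (hP b).resolve_left hb
    have hc' : -(c : F) ∈ P := by
      rw [h, neg_add, ← mul_neg, ← mul_neg]; exact P.add_mem' (P.mul_mem' hl ha') (P.mul_mem' hm hb')
    have hc : (c : F) ∉ P := fun hc => neg_not_mem_of_mem hc hc'
    rw [sgnInt_of_not_mem ha, sgnInt_of_not_mem hb, sgnInt_of_not_mem hc]; norm_num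

/-- The sign homomorphism on the free commutative ring `ℤ[(a) : a ∈ F•] → ℤ`. [cite: Milnor1970, §4, the signature (p0016 L2–L5)] -/
def sgnLift (P : RingPreordering F) : FreeCommRing Fˣ →+* ℤ := FreeCommRing.lift (sgnInt F P)

/-- `sgnLift` on generators. [cite: Milnor1970, §4, the signature (p0016 L2–L5)] -/
theorem sgnLift_og (P : RingPreordering F) (a : Fˣ) : sgnLift P (og F a) = sgnInt F P a := FreeCommRing.lift_of _ a

/-- **All defining relations of `W(F)` hold for signs** (also `(a) + (−a) ↦ 0`), so the signature descends to `W(F)`. [cite: Milnor1970, §4, the signature (p0016 L2–L5)] -/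
theorem sgnLift_eq_zero_of_mem_rels {P : RingPreordering F} (hP : ∀ a : F, a ∈ P ∨ -a ∈ P) {x : FreeCommRing Fˣ}
    (hx : x ∈ rels F) : sgnLift P x = 0 := by
  rcases hx with ⟨a, b, rfl⟩ | rfl | ⟨a, b, rfl⟩ | ⟨a, rfl⟩ | ⟨a, b, l, m, c, h, rfl⟩
  · rw [map_sub, map_mul, sgnLift_og, sgnLift_og, sgnLift_og, sgnInt_mul hP, sub_self]
  · rw [map_sub, map_one, sgnLift_og, sgnInt_one, sub_self]
  · rw [map_sub, sgnLift_og, sgnLift_og, sgnInt_mul_sq hP, sub_self]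
  · rw [map_add, sgnLift_og, sgnLift_og, sgnInt_neg hP, add_neg_cancel]
  · rw [map_sub, map_sub, map_add, sgnLift_og, sgnLift_og, sgnLift_og, sgnLift_og, sgnInt_add_rel hP h]; ring

variable (F)

/-- **The signature `W(F) →+* ℤ` of the ordering `P`**, `(a) ↦ sign_P(a)` («each embedding of F in the real field gives rise
to a ring homomorphism WF → Wℝ ≅ Z called the signature»). [cite: Milnor1970, §4 «a ring homomorphism WF → Wℝ ≅ Z called the signature» (p0016 L2–L5)] -/
def signature (P : RingPreordering F) (hP : ∀ a : F, a ∈ P ∨ -a ∈ P) : WittRing F →+* ℤ :=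
  Ideal.Quotient.lift (Ideal.span (rels F)) (sgnLift P) fun x hx => by
    have h : Ideal.span (rels F) ≤ RingHom.ker (sgnLift P) :=
      Ideal.span_le.2 fun y hy => (RingHom.mem_ker).2 (sgnLift_eq_zero_of_mem_rels hP hy)
    exact (RingHom.mem_ker).1 (h hx)

variable {F}

/-- `signature (a) = sign_P(a)`. [cite: Milnor1970, §4 «a ring homomorphism WF → Wℝ ≅ Z called the signature» (p0016 L2–L5)] -/
theorem signature_gen (P : RingPreordering F) (hP : ∀ a : F, a ∈ P ∨ -a ∈ P) (a : Fˣ) :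
    signature F P hP (gen F a) = sgnInt F P a := by
  rw [gen_def, signature, Ideal.Quotient.lift_mk, sgnLift_og]

/-- `signature (a) = 1` for `a > 0`. [cite: Milnor1970, §4, the signature (p0016 L2–L5)] -/
theorem signature_gen_of_mem {P : RingPreordering F} (hP : ∀ a : F, a ∈ P ∨ -a ∈ P) {a : Fˣ} (h : (a : F) ∈ P) :
    signature F P hP (gen F a) = 1 := by rw [signature_gen, sgnInt_of_mem h]

/-- `signature (a) = −1` for `a < 0`. [cite: Milnor1970, §4, the signature (p0016 L2–L5)] -/
theorem signature_gen_of_not_mem {P : RingPreordering F} (hP : ∀ a : F, a ∈ P ∨ -a ∈ P) {a : Fˣ} (h : (a : F) ∉ P) :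
    signature F P hP (gen F a) = -1 := by rw [signature_gen, sgnInt_of_not_mem h]

/-- `signature (−1) = −1`. [cite: Milnor1970, §4, the signature (p0016 L2–L5)] -/
theorem signature_gen_neg_one (P : RingPreordering F) (hP : ∀ a : F, a ∈ P ∨ -a ∈ P) : signature F P hP (gen F (-1)) = -1 := by
  rw [gen_neg_one, map_neg, map_one]

/-- **«each such signature carries the ideal IF to 2Z».** [cite: Milnor1970, §4 «each such signature carries the ideal IF to 2Z, and hence carries the intersection of the ideals IⁿF to ∩ 2ⁿZ = 0» (p0016 L14–L15)] -/
theorem map_fundIdeal_le (P : RingPreordering F) (hP : ∀ a : F, a ∈ P ∨ -a ∈ P) :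
    Ideal.map (signature F P hP) (fundIdeal F) ≤ Ideal.span {(2 : ℤ)} := by
  rw [fundIdeal, Ideal.map_span, Ideal.span_le]
  rintro _ ⟨_, ⟨a, rfl⟩, rfl⟩
  rw [SetLike.mem_coe, Ideal.mem_span_singleton, map_sub, map_one, signature_gen]
  by_cases h : (a : F) ∈ P
  · rw [sgnInt_of_mem h, sub_self]; exact dvd_zero 2
  · rw [sgnInt_of_not_mem h]; exact ⟨-1, by norm_num⟩

/-- **The signature carries `Iⁿ` into `2ⁿℤ`.** [cite: Milnor1970, §4 «each such signature carries the ideal IF to 2Z, and hence carries the intersection of the ideals IⁿF to ∩ 2ⁿZ = 0» (p0016 L14–L15)] -/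
theorem two_pow_dvd_signature (P : RingPreordering F) (hP : ∀ a : F, a ∈ P ∨ -a ∈ P) {n : ℕ} {x : WittRing F}
    (hx : x ∈ fundIdeal F ^ n) : (2 : ℤ) ^ n ∣ signature F P hP x := by
  have h1 : signature F P hP x ∈ Ideal.map (signature F P hP) (fundIdeal F ^ n) := Ideal.mem_map_of_mem _ hx
  rw [Ideal.map_pow] at h1
  have h2 : Ideal.map (signature F P hP) (fundIdeal F) ^ n ≤ Ideal.span {(2 : ℤ)} ^ n := Ideal.pow_right_mono (map_fundIdeal_le P hP) n
  have h3 := h2 h1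
  rwa [Ideal.span_singleton_pow, Ideal.mem_span_singleton] at h3

/-- **«and hence carries the intersection of the ideals IⁿF to ∩ 2ⁿZ = 0».** [cite: Milnor1970, §4 «each such signature carries the ideal IF to 2Z, and hence carries the intersection of the ideals IⁿF to ∩ 2ⁿZ = 0» (p0016 L14–L15)] -/
theorem signature_eq_zero_of_forall_mem (P : RingPreordering F) (hP : ∀ a : F, a ∈ P ∨ -a ∈ P) {x : WittRing F}
    (hx : ∀ n, x ∈ fundIdeal F ^ n) : signature F P hP x = 0 := by
  by_contra h
  have h1 := two_pow_dvd_signature P hP (hx (signature F P hP x).natAbs)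
  have h2 : 2 ^ (signature F P hP x).natAbs ∣ (signature F P hP x).natAbs := by
    simpa [Int.natAbs_pow] using Int.natAbs_dvd_natAbs.2 h1
  exact absurd (Nat.le_of_dvd (Int.natAbs_pos.2 h) h2) (not_le.2 Nat.lt_two_pow_self)

/-- For a formally real field (`−1` not a sum of squares) `ℤ → W(F)` is injective: a signature exists and is the
identity on `ℤ`. [cite: Milnor1970, §4 «a ring homomorphism WF → Wℝ ≅ Z called the signature» (p0016 L2–L5)] -/
theorem intCast_injective (h : ¬ IsSumSq (-1 : F)) : Function.Injective (Int.cast : ℤ → WittRing F) := by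
  obtain ⟨P, hP⟩ := exists_total_ringPreordering h
  intro m n hmn
  have := congrArg (signature F P hP) hmn
  rwa [map_intCast, map_intCast] at this

/-- For a formally real field `k · (1) ≠ 0` in `W(F)` for `k ≠ 0`. [cite: Milnor1970, §4 «a ring homomorphism WF → Wℝ ≅ Z called the signature» (p0016 L2–L5)] -/
theorem intCast_ne_zero (h : ¬ IsSumSq (-1 : F)) {k : ℤ} (hk : k ≠ 0) : (k : WittRing F) ≠ 0 := fun h0 =>
  hk (intCast_injective h (by rw [h0, Int.cast_zero]))

end WittRing

end Signature

end Literature.RingTheory.KTheory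

end
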